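import Literature.AlgebraicGeometry.CossartPiltant200819.Thm11ProjectiveIntegral2019
import Literature.AlgebraicGeometry.Resolution.ChowLemmaRing
import Literature.AlgebraicGeometry.Resolution.ResolutionOfSingularities
import Literature.AlgebraicGeometry.Morphisms.IsoOverOpen
import HarnessLib

/-!
# Crux `NoZenoR` (stmt-ResolutionOfSingularities-19943) — Lipman (1.2) 1), first step: «some affine open neighborhood of
# `w` is a dense open subscheme of a scheme `W*` which is PROJECTIVE over `Spec(R)`; we may replace `W` by `W*`»

Route `ResolutionOfSingularities/HomologicalConductor` (cell decomp-res, hand leafhand-res-homologicalconduct-12 g1).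
OURS: AI-written, weaker than expert review; nothing here is a statement of the manuscript under review (Hironaka 2017).
SUPPORT level (`--supports stmt-19943`), counted 0.  Def-free, FACT-FREE.

The projective model of an affine birational model (Lipman, Publ. IHÉS 36 (1969), proof of Prop. (1.2) 1), p. 200, first
sentence): for `g : Y → Spec R` affine of finite type, `Y` integral, birational (an isomorphism over a dense open `U`), there
is an integral `W`, PROJECTIVE over `R` (closed `R`-immersion into some `ℙⁿ_R`, the tree's
`Crystalline.IsProjectiveOverRing`), with an OPEN IMMERSION `j : Y → W` over `Spec R`, and `W → Spec R` is again
birational — an isomorphism over the SAME `U`.  Construction: `Y ↪ ℙⁿ_R` is an immersion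
(`ChowLemmaRing.exists_immersion_projOver`, Görtz–Wedhorn I §(12.15)); `W` is its scheme-theoretic image (Mathlib
`Scheme.Hom.image`; integral by `ChowLemmaProof.isIntegral_image`; `Y → W` an open immersion since the immersion is
quasi-compact).  Birationality of `W`: over `U` the open immersion `g⁻¹U → g_W⁻¹U` is proper (its composite with the
separated `g_W⁻¹U → U` is the isomorphism `g⁻¹U → U`), hence has clopen, non-empty range in the irreducible `g_W⁻¹U`, so it
is an isomorphism, and so is `g_W⁻¹U → U`.

* `isIso_morphismRestrict_of_isOpenImmersion_comp` — the clopen argument: `j ≫ g_W = g`, `j` an open immersion, `W`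
  irreducible, `g_W` separated, `g` an isomorphism over `U` with `g⁻¹U ≠ ∅` ⇒ `g_W` is an isomorphism over `U`.
* `exists_projectiveModel_of_isAffine` — the projective model `W*` with `j`, `g_W`, projectivity, birationality.

No crux, kill test or summit statement is proved; resolution of singularities in positive characteristic is NOT proved.

## References
* J. Lipman, *Rational singularities …*, Publ. Math. IHÉS 36 (1969): proof of Prop. (1.2) 1), p. 200. [Lipman1969]
* U. Görtz, T. Wedhorn, *Algebraic Geometry I* (2020): §(12.15), Rem. 10.32 (scheme-theoretic image of a quasi-compact
  immersion). [GortzWedhorn2020]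
-/

noncomputable section

-- single-problem summit: the doubled namespace component `ResolutionOfSingularities` is forced
set_option linter.dupNamespace false

namespace Summit.ResolutionOfSingularities.ResolutionOfSingularities.Theorems.NoZeno.RationalAscent

open CategoryTheory CategoryTheory.Limits AlgebraicGeometry TopologicalSpace
open Literature.AlgebraicGeometry.Resolution Literature.AlgebraicGeometry.Morphisms
open Literature.AlgebraicGeometry

universe u

/-! ## The clopen argument -/

/-- **An open immersion over the base which is an isomorphism followed by a separated morphism is an isomorphism over the
good open.**  `j : Y → W` an open immersion, `g_W : W → S` separated, `W` irreducible, and `j ≫ g_W` an isomorphism over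
the open `U ⊆ S` with `(j ≫ g_W)⁻¹U` non-empty: then `g_W` is an isomorphism over `U`.  (The open immersion
`(j ≫ g_W)⁻¹U → g_W⁻¹U` is proper by cancellation, so its range is clopen and non-empty in the irreducible `g_W⁻¹U`.)
[cite: GortzWedhorn2020, Rem. 10.32] -/
theorem isIso_morphismRestrict_of_isOpenImmersion_comp {Y W S : Scheme.{u}} [IsIntegral W]
    (j : Y ⟶ W) [IsOpenImmersion j] (gW : W ⟶ S) [IsSeparated gW] (U : S.Opens)
    [hiso : IsIso ((j ≫ gW) ∣_ U)] (hne : (((j ≫ gW) ⁻¹ᵁ U : Y.Opens) : Set Y).Nonempty) :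
    IsIso (gW ∣_ U) := by
  -- the factorisation `(j ≫ g_W)|_U = j|_{g_W⁻¹U} ≫ g_W|_U`
  have hfac : (j ≫ gW) ∣_ U = (j ∣_ gW ⁻¹ᵁ U) ≫ (gW ∣_ U) := morphismRestrict_comp j gW U
  have hisoc : IsIso ((j ∣_ gW ⁻¹ᵁ U) ≫ (gW ∣_ U)) := by
    have h := hiso
    rwa [hfac] at h
  haveI : IsProper ((j ∣_ gW ⁻¹ᵁ U) ≫ (gW ∣_ U)) := MorphismProperty.of_isIso @IsProper _
  haveI : IsProper (j ∣_ gW ⁻¹ᵁ U) := IsProper.of_comp (j ∣_ gW ⁻¹ᵁ U) (gW ∣_ U)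
  -- `g_W⁻¹U` is integral (a non-empty open of the integral `W`)
  obtain ⟨y, hy⟩ := hne
  have hjy : j y ∈ gW ⁻¹ᵁ U := by
    change y ∈ j ⁻¹ᵁ (gW ⁻¹ᵁ U)
    rw [← Scheme.Hom.comp_preimage]; exact hy
  haveI : Nonempty ↥((gW ⁻¹ᵁ U : W.Opens) : Scheme.{u}) := ⟨(⟨j y, hjy⟩ : (gW ⁻¹ᵁ U : W.Opens))⟩
  haveI : IsIntegral ((gW ⁻¹ᵁ U : W.Opens) : Scheme.{u}) := isIntegral_of_isOpenImmersion (gW ⁻¹ᵁ U).ι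
  -- the range of the proper open immersion `j|_{g_W⁻¹U}` is clopen and non-empty, hence everything
  have hrange : Set.range (j ∣_ gW ⁻¹ᵁ U) = Set.univ := by
    refine IsClopen.eq_univ ⟨(j ∣_ gW ⁻¹ᵁ U).isClosedMap.isClosed_range,
      (j ∣_ gW ⁻¹ᵁ U).isOpenEmbedding.isOpen_range⟩ ?_
    have hy' : y ∈ (j ≫ gW) ⁻¹ᵁ U := hy
    exact ⟨(j ∣_ gW ⁻¹ᵁ U) ⟨y, by rwa [Scheme.Hom.comp_preimage] at hy'⟩, Set.mem_range_self _⟩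
  haveI : Epi (j ∣_ gW ⁻¹ᵁ U).base :=
    (TopCat.epi_iff_surjective _).mpr (Set.range_eq_univ.mp hrange)
  haveI : IsIso (j ∣_ gW ⁻¹ᵁ U) := IsOpenImmersion.isIso _
  exact IsIso.of_isIso_comp_left (j ∣_ gW ⁻¹ᵁ U) (gW ∣_ U)

/-! ## The projective model -/

/-- **Projective model of an affine birational model of finite type** (Lipman (1.2) 1), first step; Görtz–Wedhorn I
§(12.15) + scheme-theoretic image): for `g : Y → Spec R` with `Y` affine and integral, `g` locally of finite type and
birational, there are an integral `W`, an open immersion `j : Y → W` and `g_W : W → Spec R` with `j ≫ g_W = g`, `g_W`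
proper, `W` projective over `R` (`Crystalline.IsProjectiveOverRing`), and `g_W` birational.
[cite: Lipman1969, proof of Proposition (1.2) 1), p. 200] [cite: GortzWedhorn2020, §(12.15) p. 440] -/
theorem exists_projectiveModel_of_isAffine {R : Type u} [CommRing R] {Y : Scheme.{u}} [IsAffine Y] [IsIntegral Y]
    (g : Y ⟶ Spec (.of R)) [LocallyOfFiniteType g] (hg : IsBirational g) :
    ∃ (W : Scheme.{u}) (_ : IsIntegral W) (j : Y ⟶ W) (_ : IsOpenImmersion j) (gW : W ⟶ Spec (.of R))
      (_ : IsProper gW), j ≫ gW = g ∧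
      Crystalline.IsProjectiveOverRing (Over.mk gW : Motives.SchemeOver R) ∧ IsBirational gW := by
  obtain ⟨n, ρ, hρ, hρg⟩ := ChowLemmaRing.exists_immersion_projOver g
  -- `ρ` is quasi-compact (its composite with the separated `ℙⁿ_R → Spec R` is the affine `g`)
  haveI : QuasiCompact (ρ ≫ (ChowLemmaRing.projOver R n).hom) := hρg ▸ inferInstance
  haveI : QuasiCompact ρ := .of_comp ρ (ChowLemmaRing.projOver R n).hom
  haveI : IsImmersion ρ := hρ
  -- the scheme-theoretic image
  let W : Scheme.{u} := ρ.image
  let j : Y ⟶ W := ρ.toImage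
  let gW : W ⟶ Spec (.of R) := ρ.imageι ≫ (ChowLemmaRing.projOver R n).hom
  haveI hWint : IsIntegral W := ChowLemmaProof.isIntegral_image ρ
  have hjg : j ≫ gW = g := by
    simp only [j, gW, W, Scheme.Hom.toImage_imageι_assoc, hρg]
  have hprojOver : ChowLemmaRing.IsProjOver (Over.mk gW : Motives.SchemeOver R) :=
    ⟨n, Over.homMk ρ.imageι rfl, by
      change IsClosedImmersion ρ.imageι
      infer_instance⟩
  haveI hprop : IsProper gW := hprojOver.isProper
  have hproj : Crystalline.IsProjectiveOverRing (Over.mk gW : Motives.SchemeOver R) :=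
    (ChowLemmaRing.isProjOver_iff_isProjectiveOverRing _).mp hprojOver
  -- birationality over the same dense open
  obtain ⟨U, hU, hU', hiso⟩ := hg
  haveI := hiso
  haveI : IsIso ((j ≫ gW) ∣_ U) := by rw [hjg]; infer_instance
  have hne : (((j ≫ gW) ⁻¹ᵁ U : Y.Opens) : Set Y).Nonempty := by rw [hjg]; exact hU'.nonempty
  haveI : IsIso (gW ∣_ U) := isIso_morphismRestrict_of_isOpenImmersion_comp j gW U hne
  refine ⟨W, hWint, j, inferInstance, gW, hprop, hjg, hproj, U, hU, ?_, inferInstance⟩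
  -- `g_W⁻¹U` is a non-empty open of the irreducible `W`, hence dense
  obtain ⟨y, hy⟩ := hne
  refine (gW ⁻¹ᵁ U).2.dense ⟨j y, ?_⟩
  change y ∈ j ⁻¹ᵁ (gW ⁻¹ᵁ U)
  rw [← Scheme.Hom.comp_preimage]; exact hy

end Summit.ResolutionOfSingularities.ResolutionOfSingularities.Theorems.NoZeno.RationalAscent

end
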